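import Summits.NavierStokesRegularity.TurbBounds.SpectralFormFreeSlip
import Summits.NavierStokesRegularity.TurbBounds.FSU1.Cover
import HarnessLib

/-!
# Row FS-U1″ — `Nu ≤ (25/164)·Ra^{5/12} − 1/4` for every `Ra ≥ 10⁶` (2-D Rayleigh–Bénard convection between FREE-SLIP isothermal walls,
# any Prandtl number and horizontal period), from two named hypotheses, with the finite part KERNEL-CHECKED
(cell `pub-turb` / `turb-bounds`, row 6 of the v2 ledger; written by pub-turb-sos, planner-pub-turb-sos-g19-0, 2026-08-22; TREE MODULE — landed as
p333405 (sos manifest B1″ item 10/10, LEAD decisions 114 (B) / 140 (A); referee kernel read chk_fsu1 PASS, gen 55); docstring erratum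
w-ix-3 (wording only: statements, proofs and imports byte-unchanged)).

HONEST FRAMING: rigorous bounds for the stated PDE and boundary conditions; no claim about physical turbulence beyond the bound.

THE THEOREM. `nusselt_bound (Nu) (hRed : FreeSlipReduction Nu) (hA : FSU1ModeLemma) : FSU1Claim Nu`, i.e. `∀ Ra ≥ 10⁶, Nu Ra ≤ 25/164·Ra^{5/12} − 1/4`,
from (1) the cited free-slip background reduction `SpectralFormFreeSlip.FreeSlipReduction` (Whitehead–Doering 2011; a published theorem USED, never
proved here) and (2) the cell-made PER-MODE ANALYTIC LEMMA `FSU1ModeLemma` (HOME/pub-turb-sos/p2fs/FS-PROOF-DRAFT.md §3.2–3.9 = Lemmas I, P, S, C, the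
Schur step and the monotonicity reduction; refereed G1 PASS; PROVED in `TurbBounds/FSU1/Mode/M18ModeLemma.lean` as `FSU1.Mode.fsu1ModeLemma`
(sos manifest B1‴, p339616, LEAD decision 122) — kept as a named hypothesis of `nusselt_bound` so that the row theorem's trust surface is
displayed, exactly as `TailLemma` was for row P2-R0 before `P2R0Tail.lean`; the hypothesis-free corollary
`Results.FSU1.nusselt_bound_of_freeSlipReduction : ∀ Nu, FreeSlipReduction Nu → FSU1Claim Nu` is proved in `Results/FSU1Spectral.lean`
(B1⁗, p339945), so the cited reduction `FreeSlipReduction` [WD11] is the only non-kernel ingredient of the row).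
Everything else is PROVED here and in `TurbBounds/FSU1/*`: the two-layer profile is
admissible (`profile_tauFS`) with `∫₀¹ τ′² = Ra^{5/12}/(2D)` (`sq_integral_tauFS`), the 481 cell inequalities (A_cell) and the corner inequality (A_corner)
hold over `ℝ` (`FSU1.cells_ok`, `FSU1.corner_p0`: exact rational criteria run by the kernel, `decide +kernel`, and the enclosure lemma
`FSU1.cellIneq_of_check` relating them to the real transcendental quantities `e^{−x}`, `sinh`, `√·`, `π`), the cells cover `(0, κ_I]`
(`FSU1.cells_cover`), and the scalar lines incl. (I₀) hold (`FSU1.scalarLines_p0`).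

WHAT `FSU1ModeLemma` SAYS (TailLemma-style, quantified over the rational parameters so that it is a genuine lemma schema, not the row restated): for
every parameter tuple `p = (a, b, D, ρ_I, u_I)` satisfying `ScalarLines p`, every `Ra ≥ 10⁶` and every wavenumber `k > 0`, IF the scaled wavenumber
`κ = k·Ra^{−1/4}` lies in a cell `[κa, κb]` carrying (A_cell) (`CellIneq p κa κb ε`), OR `κ > κ_I` and (A_corner) holds (`CornerIneq p ε`), THEN the
free-slip mode functional with weights `(a, b)` and the two-layer profile `tauFS p.D Ra` is `≥ 0` on the free-slip class. Its content is exactly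
FS-PROOF-DRAFT 3.2 (Young) + 3.3 (regime I from (I₀)) + 3.4 (parity) + 3.5–3.6 (slope representation, sector stiffness, `f_o ≥ 1`, the even-sector
bound) + 3.7 (layer coupling with `‖H_ρ‖² ≤ PH(ρ)`, `j(ρ) ≤ PJ(ρ)` on `[0,1]`, layer Poincaré) + 3.8 (Schur) + 3.9 (monotonicity in `(κ, Ra)` on a cell /
on the edge). VACUITY: `CellIneq`/`CornerIneq`/`ScalarLines` are all satisfiable (they are proved for `p0` in `FSU1/P0.lean`, `FSU1/Cover.lean`), so the
hypothesis is not vacuously consumable; and `FreeSlipReduction` is satisfiable (`freeSlipReduction_conduction`).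
-/

set_option linter.style.longLine false
set_option autoImplicit false

namespace Summit.NavierStokesRegularity.TurbBounds.Results.FSU1

open MeasureTheory Set SpectralForm SpectralFormFreeSlip
open Summit.NavierStokesRegularity.TurbBounds.FSU1

/-! ## 1. The two-layer background profile -/

/-- Layer thickness `δ = D·Ra^{−5/12}`. -/
noncomputable def delta (D : ℚ) (Ra : ℝ) : ℝ := (D : ℝ) / Ra ^ ((5 : ℝ) / 12)

/-- Piecewise-constant profile derivative with layers of thickness `δ` at both walls: `−1/(2δ)` on `[0, δ] ∪ (1−δ, 1]`, `0` between
(FS-PROOF-DRAFT 3.1 with `γ = 1/2`, linear `η`). -/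
noncomputable def tauLayer (δ : ℝ) (z : ℝ) : ℝ :=
  if z ≤ δ then -(1 / (2 * δ)) else if z ≤ 1 - δ then 0 else -(1 / (2 * δ))

/-- The FS-U1″ profile derivative at Rayleigh number `Ra`: `tauLayer (D·Ra^{−5/12})`. -/
noncomputable def tauFS (D : ℚ) (Ra : ℝ) : ℝ → ℝ := tauLayer (delta D Ra)

/-- Integrability and the integral over `[0,1]` of a function that is constant on the three open pieces `(0,δ)`, `(δ,1−δ)`, `(1−δ,1)`. -/
theorem pieces_integral {δ cL cM : ℝ} (h0 : 0 < δ) (h1 : δ ≤ 1 / 2) {f : ℝ → ℝ}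
    (hL : EqOn f (fun _ => cL) (Ioo 0 δ)) (hM : EqOn f (fun _ => cM) (Ioo δ (1 - δ)))
    (hR : EqOn f (fun _ => cL) (Ioo (1 - δ) 1)) :
    IntervalIntegrable f volume 0 1 ∧ ∫ z in (0 : ℝ)..1, f z = δ * cL + (1 - 2 * δ) * cM + δ * cL := by
  have hδ1 : δ ≤ 1 - δ := by linarith
  have hδ2 : 1 - δ ≤ 1 := by linarith
  have I1 : IntervalIntegrable f volume 0 δ :=
    (intervalIntegrable_const (c := cL)).congr_uIoo (by rw [uIoo_of_le h0.le]; exact hL.symm)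
  have I2 : IntervalIntegrable f volume δ (1 - δ) :=
    (intervalIntegrable_const (c := cM)).congr_uIoo (by rw [uIoo_of_le hδ1]; exact hM.symm)
  have I3 : IntervalIntegrable f volume (1 - δ) 1 :=
    (intervalIntegrable_const (c := cL)).congr_uIoo (by rw [uIoo_of_le hδ2]; exact hR.symm)
  have V1 : ∫ z in (0 : ℝ)..δ, f z = δ * cL := by
    rw [intervalIntegral.integral_congr_Ioo_of_le h0.le hL]
    simp only [intervalIntegral.integral_const, smul_eq_mul]; ring
  have V2 : ∫ z in δ..(1 - δ), f z = (1 - 2 * δ) * cM := by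
    rw [intervalIntegral.integral_congr_Ioo_of_le hδ1 hM]
    simp only [intervalIntegral.integral_const, smul_eq_mul]; ring
  have V3 : ∫ z in (1 - δ)..(1 : ℝ), f z = δ * cL := by
    rw [intervalIntegral.integral_congr_Ioo_of_le hδ2 hR]
    simp only [intervalIntegral.integral_const, smul_eq_mul]; ring
  have S12 := intervalIntegral.integral_add_adjacent_intervals I1 I2
  have S123 := intervalIntegral.integral_add_adjacent_intervals (I1.trans I2) I3
  refine ⟨(I1.trans I2).trans I3, ?_⟩
  rw [← S123, ← S12, V1, V2, V3]

/-- `τ′ = −1/(2δ)` on the open bottom layer `(0, δ)`. -/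
theorem tauLayer_eqOn_left (δ : ℝ) : EqOn (tauLayer δ) (fun _ => -(1 / (2 * δ))) (Ioo 0 δ) := by
  intro z hz; simp only [tauLayer]; rw [if_pos hz.2.le]
/-- `τ′ = 0` on the open bulk `(δ, 1−δ)`. -/
theorem tauLayer_eqOn_mid (δ : ℝ) : EqOn (tauLayer δ) (fun _ => (0 : ℝ)) (Ioo δ (1 - δ)) := by
  intro z hz; simp only [tauLayer]; rw [if_neg (not_le.mpr hz.1), if_pos hz.2.le]
/-- `τ′ = −1/(2δ)` on the open top layer `(1−δ, 1)` (needs `δ ≤ 1/2`). -/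
theorem tauLayer_eqOn_right {δ : ℝ} (h1 : δ ≤ 1 / 2) : EqOn (tauLayer δ) (fun _ => -(1 / (2 * δ))) (Ioo (1 - δ) 1) := by
  intro z hz; simp only [tauLayer]
  have hz1 : ¬ z ≤ δ := not_le.mpr (by linarith [hz.1])
  rw [if_neg hz1, if_neg (not_le.mpr hz.1)]

/-- The two-layer profile is admissible background data: `τ′, τ′² ∈ L¹(0,1)`, `∫₀¹ τ′ = −1`. -/
theorem profile_tauLayer {δ : ℝ} (h0 : 0 < δ) (h1 : δ ≤ 1 / 2) : Profile (tauLayer δ) := by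
  have hL := tauLayer_eqOn_left δ
  have hM := tauLayer_eqOn_mid δ
  have hR := tauLayer_eqOn_right h1
  obtain ⟨hint, hval⟩ := pieces_integral h0 h1 hL hM hR
  have hL2 : EqOn (fun z => tauLayer δ z ^ 2) (fun _ => (-(1 / (2 * δ))) ^ 2) (Ioo 0 δ) := fun z hz => by
    simp only [hL hz]
  have hM2 : EqOn (fun z => tauLayer δ z ^ 2) (fun _ => (0 : ℝ) ^ 2) (Ioo δ (1 - δ)) := fun z hz => by
    simp only [hM hz]
  have hR2 : EqOn (fun z => tauLayer δ z ^ 2) (fun _ => (-(1 / (2 * δ))) ^ 2) (Ioo (1 - δ) 1) := fun z hz => by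
    simp only [hR hz]
  obtain ⟨hint2, _⟩ := pieces_integral h0 h1 hL2 hM2 hR2
  refine ⟨hint, hint2, ?_⟩
  rw [hval]
  field_simp
  ring

/-- `∫₀¹ τ′² = 1/(2δ)` for the two-layer profile. -/
theorem sq_integral_tauLayer {δ : ℝ} (h0 : 0 < δ) (h1 : δ ≤ 1 / 2) : ∫ z in (0 : ℝ)..1, tauLayer δ z ^ 2 = 1 / (2 * δ) := by
  have hL := tauLayer_eqOn_left δ
  have hM := tauLayer_eqOn_mid δ
  have hR := tauLayer_eqOn_right h1
  have hL2 : EqOn (fun z => tauLayer δ z ^ 2) (fun _ => (-(1 / (2 * δ))) ^ 2) (Ioo 0 δ) := fun z hz => by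
    simp only [hL hz]
  have hM2 : EqOn (fun z => tauLayer δ z ^ 2) (fun _ => (0 : ℝ) ^ 2) (Ioo δ (1 - δ)) := fun z hz => by
    simp only [hM hz]
  have hR2 : EqOn (fun z => tauLayer δ z ^ 2) (fun _ => (-(1 / (2 * δ))) ^ 2) (Ioo (1 - δ) 1) := fun z hz => by
    simp only [hR hz]
  obtain ⟨_, hval⟩ := pieces_integral h0 h1 hL2 hM2 hR2
  rw [hval]
  field_simp
  ring

/-- `δ(Ra) = D/Ra^(5/12) > 0` for `D > 0`, `Ra > 0`. -/
theorem delta_pos {D : ℚ} (hD : 0 < D) {Ra : ℝ} (hRa : 0 < Ra) : 0 < delta D Ra := by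
  unfold delta; exact div_pos (by exact_mod_cast hD) (Real.rpow_pos_of_pos hRa _)

/-- Disjoint layers: `δ ≤ 1/2` for `Ra ≥ 10⁶` once `(2D)¹² ≤ 10³⁰ = Ra₀⁵`. -/
theorem delta_le_half {D : ℚ} (hD2 : (2 * D) ^ 12 ≤ 10 ^ 30) {Ra : ℝ} (hRa : (10 : ℝ) ^ 6 ≤ Ra) : delta D Ra ≤ 1 / 2 := by
  have hRa0 : 0 < Ra := lt_of_lt_of_le (by norm_num) hRa
  set y : ℝ := Ra ^ ((5 : ℝ) / 12) with hy
  have hy0 : 0 < y := Real.rpow_pos_of_pos hRa0 _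
  have hy12 : y ^ 12 = Ra ^ 5 := by
    rw [hy, ← Real.rpow_natCast, ← Real.rpow_mul hRa0.le]
    norm_num
  have h2D : (2 * (D : ℝ)) ^ 12 ≤ y ^ 12 := by
    rw [hy12]
    have h' : (2 * (D : ℝ)) ^ 12 ≤ (10 : ℝ) ^ 30 := by exact_mod_cast hD2
    calc (2 * (D : ℝ)) ^ 12 ≤ (10 : ℝ) ^ 30 := h'
      _ = ((10 : ℝ) ^ 6) ^ 5 := by norm_num
      _ ≤ Ra ^ 5 := pow_le_pow_left₀ (by norm_num) hRa 5
  have h2D' : 2 * (D : ℝ) ≤ y := le_of_pow_le_pow_left₀ (by norm_num) hy0.le h2D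
  unfold delta
  rw [div_le_iff₀ hy0]
  linarith

/-! ## 2. The per-mode analytic lemma of the chain (NAMED HYPOTHESIS) -/

/-- **Named hypothesis `FSU1ModeLemma`** — the per-mode analytic lemma of FS-PROOF-DRAFT §3.2–3.9 (cell-made mathematics, refereed G1 PASS; PROVED as
`FSU1.Mode.fsu1ModeLemma` in `TurbBounds/FSU1/Mode/M18ModeLemma.lean`, B1‴ p339616 — kept here as a named `Prop` and as a hypothesis of
the row theorem `nusselt_bound` so that its trust surface is displayed; discharged in `Results/FSU1Spectral.lean`). TRANSCRIPTION: for every rational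
parameter tuple `p` with `ScalarLines p`, every `Ra ≥ 10⁶` and every horizontal wavenumber `k > 0`, writing `κ := k·Ra^{−1/4}`: IF `κ` lies in a cell
`[κa, κb] ⊆ [0, κ_I]` on which the cell inequality (A_cell) `CellIneq p κa κb ε` holds for some `ε`, OR `κ > κ_I` and the corner inequality (A_corner)
`CornerIneq p ε` holds for some `ε`, THEN the sign-free free-slip mode functional with weights `(a, b) = (p.a, p.b)` and the two-layer profile
`tauFS p.D Ra` is nonnegative on the free-slip class: `0 ≤ fsModeForm Ra a b (tauFS p.D Ra) k v θ` for every `FreeSlipPair v θ`.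
CONTENT (proof of record HOME/pub-turb-sos/p2fs/FS-PROOF-DRAFT.md): 3.2 Young per wavenumber with `u ∈ [a²/(4b), 1]`; 3.3 Lemma I (regime I
`ρ = κD·Ra^{−1/6} ≥ ρ_I`, layer quarter-wave Poincaré, closed by (I₀) ∈ `ScalarLines`); 3.4 Lemma P (parity ⇒ one-wall classes on `[0, 1/2]`);
3.5 slope representation (`Ω(0) = 0` is where free-slip enters); 3.6 Lemma S (sector stiffness by energy Cauchy–Schwarz; `f_o ≥ 1` by the maximum
principle; the even-sector bound `f_e ≥ 1/(1 + g₊(m̃+1)/(m̃−1) + 2ε₁/(m̃−1))`, `g₊ ≤ Ḡ`, `ε₁ ≤ 2e^{−Q}/sinh P`); 3.7 Lemma C (layer coupling: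
`c₁² = γ²δ³‖H_ρ‖²` with `‖H_ρ‖² ≤ PH(ρ)`, `c₂² = γ²J(ρ)/k²` with `j(ρ) ≤ PJ(ρ)` for `0 ≤ ρ ≤ 1` — the even polynomials `FSU1.PH`, `FSU1.PJ` are the
partial double series `m, n ≤ 12` plus the tail bound `8ρ²⁴/26!`; layer Poincaré `ν`); 3.8 the Schur step; 3.9 (a) monotonicity on a cell
(`ρ ≤ ρ_b = κbD/10`, `inf Φ` by unimodality, `F_cell` from `k ≥ κa·Ra₀^{1/4}`, `m̃ ≥ m̃(κb)`, `ε̄₁`), (b) the edge `κ > κ_I` dominated by the corner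
under the three side conditions in `ScalarLines`. The quantities `Φ, m̃, P, Q, Ḡ, ε̄₁, F_cell, F_edge` are `FSU1.Phi, mt, Pfn, Qfn, Gbar, eps1bar,
Fcell, Fedge` verbatim, and `r̄₁², r̄₂²` are `FSU1.r1sq, r2sq` with the truncated-series MAJORANTS `FSU1.PH`, `FSU1.PJ` (fsu1/README §3) in place of
the draft's `‖H_ρ‖²`, `j(ρ)` (referee gen 46 note w-viii-1). NOT VACUOUS: every antecedent is proved for `p0` in `FSU1/P0.lean`, `FSU1/Cover.lean`. -/
def FSU1ModeLemma : Prop :=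
  ∀ p : Params, ScalarLines p → ∀ Ra : ℝ, (10 : ℝ) ^ 6 ≤ Ra → ∀ k : ℝ, 0 < k →
    ((∃ ka kb eps : ℚ, CellIneq p ka kb eps ∧ (ka : ℝ) ≤ k / Ra ^ ((1 : ℝ) / 4) ∧ k / Ra ^ ((1 : ℝ) / 4) ≤ kb) ∨
      (∃ eps : ℚ, CornerIneq p eps ∧ (p.kapI : ℝ) < k / Ra ^ ((1 : ℝ) / 4))) →
    ∀ v θ : ℝ → ℝ, FreeSlipPair v θ → 0 ≤ fsModeForm Ra p.a p.b (tauFS p.D Ra) k v θ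

/-! ## 3. The row theorem -/

/-- The spectral constraint for the parameters of record at every `Ra ≥ 10⁶`, from the per-mode lemma and the KERNEL-CHECKED finite part. -/
theorem spectralConstraintFS_p0 (hA : FSU1ModeLemma) {Ra : ℝ} (hRa : (10 : ℝ) ^ 6 ≤ Ra) :
    SpectralConstraintFS Ra p0.a p0.b (tauFS p0.D Ra) := by
  intro k hk v θ hvθ
  have hRa0 : 0 < Ra := lt_of_lt_of_le (by norm_num) hRa
  refine hA p0 scalarLines_p0 Ra hRa k hk ?_ v θ hvθ
  have hκ0 : 0 < k / Ra ^ ((1 : ℝ) / 4) := div_pos hk (Real.rpow_pos_of_pos hRa0 _)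
  by_cases hκI : k / Ra ^ ((1 : ℝ) / 4) ≤ (p0.kapI : ℝ)
  · left
    obtain ⟨s, hs, h1, h2⟩ := cells_cover _ hκ0.le hκI
    exact ⟨s.ka, s.kb, s.eps, cells_ok s hs, h1, h2⟩
  · right
    exact ⟨w0.eps, corner_p0, not_le.mp hκI⟩

/-- The two-layer profile of the row is admissible for `Ra ≥ 10⁶`. -/
theorem profile_tauFS {Ra : ℝ} (hRa : (10 : ℝ) ^ 6 ≤ Ra) : Profile (tauFS p0.D Ra) :=
  profile_tauLayer (delta_pos (by decide +kernel) (lt_of_lt_of_le (by norm_num) hRa)) (delta_le_half (by decide +kernel) hRa)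

/-- `∫₀¹ τ′² = Ra^{5/12}/(2D)` for the row profile. -/
theorem sq_integral_tauFS {Ra : ℝ} (hRa : (10 : ℝ) ^ 6 ≤ Ra) :
    ∫ z in (0 : ℝ)..1, tauFS p0.D Ra z ^ 2 = Ra ^ ((5 : ℝ) / 12) / (2 * (p0.D : ℝ)) := by
  have hRa0 : 0 < Ra := lt_of_lt_of_le (by norm_num) hRa
  have h := sq_integral_tauLayer (delta_pos (D := p0.D) (by decide +kernel) hRa0) (delta_le_half (D := p0.D) (by decide +kernel) hRa)
  unfold tauFS
  rw [h]
  unfold delta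
  have hy : 0 < Ra ^ ((5 : ℝ) / 12) := Real.rpow_pos_of_pos hRa0 _
  have hDpos : (0 : ℝ) < (p0.D : ℝ) := by
    have : (0 : ℚ) < p0.D := by decide +kernel
    exact_mod_cast this
  field_simp

/-- **Row FS-U1″.** For 2-D Rayleigh–Bénard convection between free-slip isothermal walls (any Prandtl number, any horizontal period):
IF the cited free-slip background reduction holds (`FreeSlipReduction Nu`) and the per-mode analytic lemma of the chain holds (`FSU1ModeLemma`),
THEN `Nu(Ra) ≤ (25/164)·Ra^{5/12} − 1/4` for every `Ra ≥ 10⁶`. The finite part (481 cell inequalities, the corner, the cover, the scalar lines) is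
kernel-checked; the profile facts are proved. HONEST FRAMING: rigorous bounds for the stated PDE and boundary conditions; no claim about physical turbulence beyond the bound. -/
theorem nusselt_bound (Nu : ℝ → ℝ) (hRed : FreeSlipReduction Nu) (hA : FSU1ModeLemma) : FSU1Claim Nu := by
  intro Ra hRa
  have hRa0 : 0 < Ra := lt_of_lt_of_le (by norm_num) hRa
  have ha : (0 : ℝ) < (p0.a : ℝ) := by
    have : (0 : ℚ) < p0.a := by decide +kernel
    exact_mod_cast this
  have hb0 : (0 : ℝ) < (p0.b : ℝ) := by
    have : (0 : ℚ) < p0.b := by decide +kernel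
    exact_mod_cast this
  have hb1 : (p0.b : ℝ) < 1 := by
    have : p0.b < 1 := by decide +kernel
    exact_mod_cast this
  have h := hRed Ra p0.a p0.b (tauFS p0.D Ra) hRa0 ha hb0 hb1 (profile_tauFS hRa) (spectralConstraintFS_p0 hA hRa)
  rw [sq_integral_tauFS hRa] at h
  have eb : ((p0.b : ℚ) : ℝ) = 1 / 5 := by norm_num [p0]
  have eD : ((p0.D : ℚ) : ℝ) = 41 / 10 := by norm_num [p0]
  rw [eb, eD] at h
  have hy : 0 < Ra ^ ((5 : ℝ) / 12) := Real.rpow_pos_of_pos hRa0 _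
  calc Nu Ra ≤ (Ra ^ ((5 : ℝ) / 12) / (2 * (41 / 10)) - 1 / 5) / (1 - 1 / 5) := h
    _ = 25 / 164 * Ra ^ ((5 : ℝ) / 12) - 1 / 4 := by ring

/-! ## 4. Guards -/

/-- VACUITY GUARD 1: the named reduction hypothesis is satisfiable as typed (conduction value). -/
theorem freeSlipReduction_satisfiable : ∃ Nu, FreeSlipReduction Nu := ⟨_, freeSlipReduction_conduction⟩

/-- VACUITY GUARD 2: the antecedents of `FSU1ModeLemma` are all met by the parameters of record — the lemma is consumed non-vacuously
(a cell instance, the corner instance and the scalar lines). -/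
theorem modeLemma_antecedents_met :
    ScalarLines p0 ∧ (∃ r ∈ cells, CellIneq p0 r.ka r.kb r.eps) ∧ CornerIneq p0 w0.eps := by
  refine ⟨scalarLines_p0, ?_, corner_p0⟩
  obtain ⟨s, hs, _⟩ := cells_cover (p0.kapI : ℝ) (by exact_mod_cast (show (0:ℚ) ≤ p0.kapI by decide +kernel)) le_rfl
  exact ⟨s, hs, cells_ok s hs⟩

/-- SHAPE GUARD: the row theorem has exactly the advertised shape `∀ Nu, FreeSlipReduction Nu → FSU1ModeLemma → FSU1Claim Nu`. -/
example : ∀ Nu : ℝ → ℝ, FreeSlipReduction Nu → FSU1ModeLemma → FSU1Claim Nu := nusselt_bound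

end Summit.NavierStokesRegularity.TurbBounds.Results.FSU1
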